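import Summits.HodgeConjecture.HodgeConjecture.Theses.AnchorTransport

/-!
# Route AnchorTransport — `Assembly` (item stmt-HodgeConjecture-1080)

The assembly item of route `AnchorTransport` is pure logic: from the Hodge-model fact
`∀ n X, nonempty_hodgeModel n X`, `IsoInvariance`, `VariationalHodge` and `AnchorExistence`
one gets `HodgeConjecture`.  Given `X` smooth projective of dimension `n` and a rational `(p,p)`
class `c`, `AnchorExistence` produces a smooth projective family `f : 𝒳 ⟶ S`, points `s₁ s₀`,
an iso `e : X ≅ 𝒳_{s₁}` and a fibrewise-Hodge class `A` on `𝒳` with `e^*(A|_{𝒳_{s₁}}) = c` and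
`A|_{𝒳_{s₀}}` algebraic; `VariationalHodge` transports algebraicity from the anchor fibre `s₀` to
`s₁`; `IsoInvariance` moves it across `e`.  The Hodge-model fact discharges the anti-vacuity
conjunct of `HodgeConjectureFor` (`hodgeConjectureFor_iff_of_isSmoothProjective`).  This is the
same argument as the route's deciding theorem `closes`, recorded against the item's own decl.
-/

-- `Summit.HodgeConjecture.HodgeConjecture.Theorems` is the mandated namespace (single-conjunct summit:
-- Sub = Summit), which `linter.dupNamespace` flags on every declaration; the lakefile turns the
-- linter off tree-wide (weak option), restated here so stand-alone elaboration is warning-free too.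
set_option linter.dupNamespace false

namespace Summit.HodgeConjecture.HodgeConjecture.Theorems

/-- **Item stmt-HodgeConjecture-1080 (`Assembly`)** of route `AnchorTransport`:
`(∀ n X, nonempty_hodgeModel n X) → IsoInvariance → VariationalHodge → AnchorExistence →
HodgeConjecture`.  Pure logic: anchor data from `AnchorExistence`, transport of algebraicity from
the anchor fibre `s₀` to `s₁` by `VariationalHodge`, then across the iso `e : X ≅ 𝒳_{s₁}` by
`IsoInvariance`; the Hodge-model fact reduces `HodgeConjectureFor n X` to its cycle part.  The type
is literally the route decl `Summit.HodgeConjecture.HodgeConjecture.Theses.AnchorTransport.Assembly`. -/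
theorem anchorTransport_assembly_proof :
    Summit.HodgeConjecture.HodgeConjecture.Theses.AnchorTransport.Assembly := by
  unfold Summit.HodgeConjecture.HodgeConjecture.Theses.AnchorTransport.Assembly
  intro hM hIso hV hAn n X hX
  refine (Literature.AlgebraicGeometry.HodgeTheory.hodgeConjectureFor_iff_of_isSmoothProjective
    (hM n X) hX).2 ?_
  intro p c hc hpp
  obtain ⟨𝒳, S, f, s₁, s₀, e, A, hf, hirr, hsm, hfib, hAc, hs₀⟩ := hAn hX p c hc hpp
  -- transport algebraicity from the anchor fibre `s₀` to the fibre `s₁` (variational Hodge) …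
  have h₁ := hV f hf hirr hsm p A hfib ⟨s₀, hs₀⟩ s₁
  -- … and across the isomorphism `e : X ≅ 𝒳_{s₁}`
  have h₂ := hIso e p _ h₁
  rw [hAc] at h₂
  exact h₂

end Summit.HodgeConjecture.HodgeConjecture.Theorems
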